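import Mathlib.FieldTheory.Galois.Basic
import Mathlib.FieldTheory.PrimitiveElement
import Mathlib.LinearAlgebra.Lagrange
import Mathlib.RingTheory.Coprime.Lemmas
import HarnessLib

/-!
# Galois descent of label components ("the labels over `τ` form a `Gal(M₀/k)`-torsor")

Topic `FieldTheory/Galois`; theorems only, no definitions, no named facts.

**Setting.** `k ⊆ Ω` fields, `Γ` a group acting on `Ω` by ring automorphisms fixing `k`
(`SMulCommClass Γ k Ω`), `M₀/k` a finite Galois subextension of `Ω` such that every element of
`Gal(M₀/k)` is induced by some element of `Γ` (`hlift`; e.g. `Ω = k̄`, `Γ = Gal(k̄/k)` or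
`Γ = Gal(k̄/k')` for `k' ⊆ k`).  `X` is a vector space over a coefficient field `E` carrying an
`E`-linear representation `π` of `Γ` and a commuting `E`-linear action `act` of the field `Ω`,
**semilinear** in the sense `π σ ∘ act a = act (σ • a) ∘ π σ` (the situation of
`X = V ⊗_{ℚ_p} B_dR(K)` with `Ω = K̄ ⊆ B_dR(K)`, `Γ = Γ_K`, `E = ℚ̄_p` acting on `V`).  For
`τ : k → E` and an extension `μ : M₀ → E` of `τ` put

* `D_k(τ) = {x ∈ X^Γ | k acts through τ}` (the `τ`-component of the `Γ`-invariants),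
* `D_{M₀}(μ) = {x ∈ X^{Γ_{M₀}} | M₀ acts through μ}` (`Γ_{M₀}` = the elements of `Γ` fixing `M₀`
  pointwise; the `μ`-component of the `Γ_{M₀}`-invariants).

**Theorem** (`nonempty_linearEquiv_inf_of_labelComponent`): for every `E`-subspace `F ≤ X` stable
under `π(Γ)` and under `act(M₀)` there is an `E`-linear isomorphism
`D_k(τ) ∩ F ≅ D_{M₀}(μ) ∩ F`; in particular the two have the same `E`-dimension
(`finrank_inf_eq_of_labelComponent`).  The maps are "take the `μ`-component" (a Lagrange
interpolation polynomial in `act θ`, `θ` a primitive element of `M₀/k`, whose nodes are the values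
`μ(g⁻¹ θ)`, `g ∈ Gal(M₀/k)`) and "sum over lifts of `Gal(M₀/k)`"; the point is that the extensions
of `τ` to `M₀` inside `E ⊇ μ(M₀)` are exactly the `μ ∘ g⁻¹` and are permuted simply transitively,
so that a `Γ`-invariant vector is determined by any one of its label components.  No dimension
count and no finiteness of `X` is used (the statement is an explicit isomorphism), and `E` need
not be algebraically closed (all conjugates of `θ` already lie in `M₀`).

This is the coefficient-field form of the Galois descent `M₀ ⊗_k D_k = D_{M₀}` behind
"`D_{dR,L}(V) = L ⊗_K D_{dR,K}(V)`, whence `HT_{τ''}(V|_{G_L}) = HT_{τ''|_K}(V)`" (Brinon–Conrad,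
*CMI notes on p-adic Hodge theory*, Prop. 6.3.8; Patrikis, *Variations on a theorem of Tate*,
§2.3.1 (Lemma on the `Gal(E'/E)`-orbit of labels) and §2.7.1), isolated as pure linear algebra.

## References

* O. Brinon, B. Conrad, *CMI Summer School notes on p-adic Hodge theory* (2009), Prop. 6.3.8.
* S. Patrikis, *Variations on a theorem of Tate*, Mem. AMS 258 (2019), §2.3.1, §2.7.1.
* J.-P. Serre, *Local Fields*, Ch. X §1 (Galois descent for vector spaces). [folklore]
-/

noncomputable section

namespace Literature.FieldTheory.Galois

open Polynomial Module

/-! ### Polynomial calculus for one endomorphism -/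

section Endo

variable {E W : Type*} [Field E] [AddCommGroup W] [Module E W]

/-- On a vector with `T z = r • z`, the operator `p(T)` acts by the scalar `p(r)`. [folklore] -/
theorem aeval_apply_of_apply_eq_smul (T : Module.End E W) {z : W} {r : E} (hz : T z = r • z)
    (p : E[X]) : aeval T p z = p.eval r • z := by
  induction p using Polynomial.induction_on' with
  | add p q hp hq => rw [map_add, LinearMap.add_apply, hp, hq, eval_add, add_smul]
  | monomial n a =>
    rw [aeval_monomial, Module.End.mul_apply, eval_monomial]
    have hn : (T ^ n) z = r ^ n • z := by
      induction n with
      | zero => rw [pow_zero, pow_zero, one_smul, Module.End.one_apply]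
      | succ n ih =>
        rw [pow_succ, Module.End.mul_apply, hz, map_smul, ih, smul_smul, pow_succ, mul_comm]
    rw [hn, Module.algebraMap_end_apply, smul_smul]

/-- A polynomial in `T` preserves every `T`-stable subspace. [folklore] -/
theorem aeval_apply_mem_of_forall_mem (T : Module.End E W) {F : Submodule E W}
    (hF : ∀ x ∈ F, T x ∈ F) (p : E[X]) {x : W} (hx : x ∈ F) : aeval T p x ∈ F := by
  induction p using Polynomial.induction_on' with
  | add p q hp hq => rw [map_add, LinearMap.add_apply]; exact add_mem hp hq
  | monomial n a =>
    rw [aeval_monomial, Module.End.mul_apply, Module.algebraMap_end_apply]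
    refine Submodule.smul_mem _ _ ?_
    induction n with
    | zero => rwa [pow_zero, Module.End.one_apply]
    | succ n ih => rw [pow_succ', Module.End.mul_apply]; exact hF _ ih

/-- An endomorphism commuting with `T` commutes with every `p(T)`. [folklore] -/
theorem apply_aeval_of_forall_apply_eq (S T : Module.End E W) (hST : ∀ x, S (T x) = T (S x))
    (p : E[X]) (x : W) : S (aeval T p x) = aeval T p (S x) := by
  induction p using Polynomial.induction_on' with
  | add p q hp hq => rw [map_add, LinearMap.add_apply, LinearMap.add_apply, map_add, hp, hq]
  | monomial n a =>
    rw [aeval_monomial, Module.End.mul_apply, Module.End.mul_apply, Module.algebraMap_end_apply,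
      Module.algebraMap_end_apply, map_smul]
    congr 1
    induction n with
    | zero => rw [pow_zero, Module.End.one_apply, Module.End.one_apply]
    | succ n ih => rw [pow_succ', Module.End.mul_apply, Module.End.mul_apply, hST, ih]

end Endo

/-! ### Lagrange components of an endomorphism along an injective family of nodes -/

section Lagrange

variable {E W : Type*} [Field E] [AddCommGroup W] [Module E W] (T : Module.End E W)
  {ι : Type*} [Fintype ι] [DecidableEq ι] {v : ι → E}

/-- The Lagrange polynomial `L_i(T)` is the identity on `T`-eigenvectors of eigenvalue `v i` and
kills those of eigenvalue `v j`, `j ≠ i`. [folklore] -/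
theorem aeval_basis_apply_of_apply_eq_smul (hv : Function.Injective v) {z : W} {j : ι}
    (hz : T z = v j • z) (i : ι) :
    aeval T (Lagrange.basis Finset.univ v i) z = if i = j then z else 0 := by
  rw [aeval_apply_of_apply_eq_smul T hz]
  split_ifs with h
  · subst h
    rw [Lagrange.eval_basis_self hv.injOn (Finset.mem_univ _), one_smul]
  · rw [Lagrange.eval_basis_of_ne h (Finset.mem_univ _), zero_smul]

/-- `∑_i L_i(T) = 1`. [folklore] -/
theorem sum_aeval_basis_apply [Nonempty ι] (hv : Function.Injective v) (x : W) :
    ∑ i, aeval T (Lagrange.basis Finset.univ v i) x = x := by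
  rw [← LinearMap.sum_apply, ← map_sum, Lagrange.sum_basis hv.injOn Finset.univ_nonempty, map_one,
    Module.End.one_apply]

/-- **Component extraction**: if `x = ∑_j y_j` with `T y_j = v_j • y_j`, then `L_i(T) x = y_i`.
[folklore] -/
theorem aeval_basis_sum_eq (hv : Function.Injective v) {y : ι → W}
    (hy : ∀ j, T (y j) = v j • y j) (i : ι) :
    aeval T (Lagrange.basis Finset.univ v i) (∑ j, y j) = y i := by
  rw [map_sum]
  simp_rw [aeval_basis_apply_of_apply_eq_smul T hv (hy _) i]
  rw [Finset.sum_ite_eq]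
  simp

/-- If the nodal polynomial `∏_i (T - v_i)` kills `x`, then each `L_i(T) x` is a `T`-eigenvector of
eigenvalue `v_i` (as `(X - v_i) · L_i = w_i · ∏_j (X - v_j)`). [folklore] -/
theorem apply_aeval_basis_eq_smul_of_aeval_nodal_eq_zero {x : W}
    (hx : aeval T (Lagrange.nodal Finset.univ v) x = 0) (i : ι) :
    T (aeval T (Lagrange.basis Finset.univ v i) x) =
      v i • aeval T (Lagrange.basis Finset.univ v i) x := by
  have hi : i ∈ (Finset.univ : Finset ι) := Finset.mem_univ i
  -- `(X - C (v i)) * L_i = C w * nodal`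
  have key : (X - C (v i)) * Lagrange.basis Finset.univ v i =
      C (Lagrange.nodalWeight Finset.univ v i) * Lagrange.nodal Finset.univ v := by
    rw [Lagrange.basis_eq_prod_sub_inv_mul_nodal_div hi, ← Lagrange.nodal_erase_eq_nodal_div hi,
      mul_left_comm, ← Lagrange.nodal_eq_mul_nodal_erase hi]
  have h := congrArg (fun q => aeval T q x) key
  simp only [map_mul, map_sub, aeval_X, aeval_C, Module.End.mul_apply, LinearMap.sub_apply,
    Module.algebraMap_end_apply, hx, smul_zero] at h
  exact sub_eq_zero.1 h

end Lagrange

/-! ### The conjugates of a primitive element and the nodal polynomial of the labels -/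

section Labels

variable {k Ω : Type*} [Field k] [Field Ω] [Algebra k Ω] (M₀ : IntermediateField k Ω)
  [FiniteDimensional k M₀] [IsGalois k M₀] (pb : PowerBasis k M₀)
  {E : Type*} [Field E] (μ : M₀ →+* E)

omit [FiniteDimensional k M₀] [IsGalois k M₀] in
/-- The conjugates `g⁻¹ θ` of a primitive element `θ` are pairwise distinct. [folklore] -/
theorem injective_symm_apply_gen : Function.Injective fun g : M₀ ≃ₐ[k] M₀ => g.symm pb.gen := by
  intro g h hgh
  have hs : (g.symm : M₀ →ₐ[k] M₀) = (h.symm : M₀ →ₐ[k] M₀) := pb.algHom_ext (by simpa using hgh)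
  have hs' : g.symm = h.symm := AlgEquiv.coe_toAlgHom_injective hs
  rw [← g.symm_symm, hs', h.symm_symm]

omit [FiniteDimensional k M₀] [IsGalois k M₀] in
/-- The label nodes `μ (g⁻¹ θ)` are pairwise distinct. [folklore] -/
theorem injective_label_nodes : Function.Injective fun g : M₀ ≃ₐ[k] M₀ => μ (g.symm pb.gen) :=
  fun _ _ hgh => injective_symm_apply_gen M₀ pb (μ.injective hgh)

/-- **`minpoly_k(θ) = ∏_{g ∈ Gal(M₀/k)} (X - g⁻¹ θ)` in `M₀[X]`** for a primitive element `θ` of the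
finite Galois extension `M₀/k`. [folklore] -/
theorem map_minpoly_gen_eq_nodal :
    (minpoly k pb.gen).map (algebraMap k M₀) =
      Lagrange.nodal Finset.univ fun g : M₀ ≃ₐ[k] M₀ => g.symm pb.gen := by
  classical
  refine eq_of_monic_of_dvd_of_natDegree_le Lagrange.nodal_monic
    ((minpoly.monic pb.isIntegral_gen).map _) ?_ ?_
  · rw [Lagrange.nodal_eq]
    refine Finset.prod_dvd_of_coprime
      ((pairwise_coprime_X_sub_C (injective_symm_apply_gen M₀ pb)).set_pairwise _) fun g _ => ?_
    rw [dvd_iff_isRoot, IsRoot.def, eval_map_algebraMap, aeval_algHom_apply, minpoly.aeval, map_zero]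
  · rw [(minpoly.monic pb.isIntegral_gen).natDegree_map, pb.natDegree_minpoly,
      Lagrange.natDegree_nodal, Finset.card_univ, ← pb.finrank, ← IsGalois.card_aut_eq_finrank,
      Nat.card_eq_fintype_card]

/-- The nodal polynomial is compatible with ring homomorphisms. [folklore] -/
theorem map_nodal {R S : Type*} [CommRing R] [CommRing S] (f : R →+* S) {ι : Type*}
    (s : Finset ι) (w : ι → R) :
    (Lagrange.nodal s w).map f = Lagrange.nodal s (f ∘ w) := by
  rw [Lagrange.nodal_eq, Lagrange.nodal_eq, Polynomial.map_prod]
  simp only [Polynomial.map_sub, map_X, map_C, Function.comp_apply]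

/-- **The labels over `τ` are the `μ ∘ g⁻¹`**: `minpoly_k(θ)` pushed to `E` along
`μ|_k = τ` is the nodal polynomial of the nodes `μ(g⁻¹ θ)`. [folklore] -/
theorem map_minpoly_gen_eq_nodal_labels :
    (minpoly k pb.gen).map (μ.comp (algebraMap k M₀)) =
      Lagrange.nodal Finset.univ fun g : M₀ ≃ₐ[k] M₀ => μ (g.symm pb.gen) := by
  rw [← Polynomial.map_map, map_minpoly_gen_eq_nodal M₀ pb, map_nodal]
  rfl

end Labels

/-! ### Semilinear representations with a commuting field action -/

section Main

variable {k Ω : Type*} [Field k] [Field Ω] [Algebra k Ω]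
  {Γ : Type*} [Group Γ] [MulSemiringAction Γ Ω]
  {E W : Type*} [Field E] [AddCommGroup W] [Module E W]
  (π : Γ →* Module.End E W) (act : Ω →+* Module.End E W)

/-- The action of the (commutative) field `Ω` is commutative. [folklore] -/
theorem act_comm (a b : Ω) (x : W) : act a (act b x) = act b (act a x) := by
  rw [← Module.End.mul_apply, ← map_mul, mul_comm, map_mul, Module.End.mul_apply]

/-- If `k` acts on `x` through `τ`, it acts through `τ` on `act a x`. [folklore] -/
theorem act_algebraMap_act_eq_smul (τ : k →+* E) {x : W}
    (hx : ∀ c : k, act (algebraMap k Ω c) x = τ c • x) (a : Ω) (c : k) :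
    act (algebraMap k Ω c) (act a x) = τ c • act a x := by
  rw [act_comm, hx, map_smul]

/-- **`act (r(θ)) = r^τ(act θ)` on vectors on which `k` acts through `τ`** (`r ∈ k[X]`, `r^τ` its
image in `E[X]`). [folklore] -/
theorem act_aeval_eq_aeval_map (τ : k →+* E) (θ : Ω) {x : W}
    (hx : ∀ c : k, act (algebraMap k Ω c) x = τ c • x) (r : k[X]) :
    act (aeval θ r) x = aeval (act θ) (r.map τ) x := by
  induction r using Polynomial.induction_on' with
  | add p q hp hq =>
    rw [map_add, map_add, LinearMap.add_apply, hp, hq, Polynomial.map_add, map_add,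
      LinearMap.add_apply]
  | monomial n c =>
    rw [aeval_monomial, map_mul, map_pow, Module.End.mul_apply, Polynomial.map_monomial,
      aeval_monomial, Module.End.mul_apply, Module.algebraMap_end_apply, ← map_pow]
    exact act_algebraMap_act_eq_smul act τ hx _ c

variable (M₀ : IntermediateField k Ω) [FiniteDimensional k M₀] [IsGalois k M₀]
  (pb : PowerBasis k M₀) (τ : k →+* E) (μ : M₀ →+* E)

/-- **The nodal polynomial of the labels, evaluated at `act θ`, kills every vector on which `k`
acts through `τ`** (it is `minpoly_k(θ)^τ (act θ) = act (minpoly_k(θ)(θ)) = 0`). [folklore] -/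
theorem aeval_nodal_labels_apply_eq_zero (hμ : ∀ c : k, μ (algebraMap k M₀ c) = τ c) {x : W}
    (hx : ∀ c : k, act (algebraMap k Ω c) x = τ c • x) :
    aeval (act ((pb.gen : M₀) : Ω))
      (Lagrange.nodal Finset.univ fun g : M₀ ≃ₐ[k] M₀ => μ (g.symm pb.gen)) x = 0 := by
  have hτ : μ.comp (algebraMap k M₀) = τ := RingHom.ext hμ
  rw [← map_minpoly_gen_eq_nodal_labels M₀ pb μ, hτ, ← act_aeval_eq_aeval_map act τ _ hx]
  have h0 : aeval ((pb.gen : M₀) : Ω) (minpoly k pb.gen) = 0 := by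
    rw [show ((pb.gen : M₀) : Ω) = M₀.val pb.gen from rfl, aeval_algHom_apply, minpoly.aeval,
      map_zero]
  rw [h0, map_zero, LinearMap.zero_apply]

omit [FiniteDimensional k M₀] [IsGalois k M₀] in
/-- **A vector on which `k` acts through `τ` and `θ` acts by `ν(θ)` is acted on by `M₀ = k[θ]`
through `ν`**, for any `ν : M₀ → E` extending `τ`. [folklore] -/
theorem act_eq_smul_of_act_gen {ν : M₀ →+* E} (hν : ∀ c : k, ν (algebraMap k M₀ c) = τ c)
    {z : W} (hz : ∀ c : k, act (algebraMap k Ω c) z = τ c • z)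
    (hzθ : act ((pb.gen : M₀) : Ω) z = ν pb.gen • z) (m : M₀) :
    act (m : Ω) z = ν m • z := by
  obtain ⟨r, rfl⟩ := pb.exists_eq_aeval' m
  have h1 : ((aeval pb.gen r : M₀) : Ω) = aeval ((pb.gen : M₀) : Ω) r := by
    rw [show ((pb.gen : M₀) : Ω) = M₀.val pb.gen from rfl, aeval_algHom_apply]; rfl
  have hν' : ν.comp (algebraMap k M₀) = τ := RingHom.ext hν
  rw [h1, act_aeval_eq_aeval_map act τ _ hz, aeval_apply_of_apply_eq_smul _ hzθ]
  congr 1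
  rw [eval_map, aeval_def, hom_eval₂, hν']

omit [FiniteDimensional k M₀] [IsGalois k M₀] in
/-- **Lifts move label components**: if `M₀` acts on `z` through `ν` and `σ ∈ Γ` induces
`g ∈ Gal(M₀/k)`, then `M₀` acts on `π σ z` through `ν ∘ g⁻¹` (semilinearity). [folklore] -/
theorem act_apply_eq_smul_of_lift
    (hπ : ∀ (σ : Γ) (a : Ω) (x : W), π σ (act a x) = act (σ • a) (π σ x))
    {ν : M₀ →+* E} {z : W} (hzν : ∀ m : M₀, act (m : Ω) z = ν m • z)
    {g : M₀ ≃ₐ[k] M₀} {σ : Γ} (hσ : ∀ m : M₀, σ • (m : Ω) = g m) (m : M₀) :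
    act (m : Ω) (π σ z) = ν (g.symm m) • π σ z := by
  have hm : σ • ((g.symm m : M₀) : Ω) = m := by rw [hσ, AlgEquiv.apply_symm_apply]
  rw [← hm, ← hπ, hzν, map_smul]

omit [FiniteDimensional k M₀] [IsGalois k M₀] in
/-- **Lifts preserve `Γ_{M₀}`-invariance**: if `z` is fixed by every element of `Γ` fixing `M₀`
pointwise and `σ` induces an automorphism of `M₀`, then so is `π σ z` (the elements fixing `M₀`
form a subgroup normalised by `σ`). [folklore] -/
theorem apply_apply_eq_of_lift {z : W}
    (hzN : ∀ σ : Γ, (∀ m : M₀, σ • (m : Ω) = m) → π σ z = z)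
    {g : M₀ ≃ₐ[k] M₀} {σ : Γ} (hσ : ∀ m : M₀, σ • (m : Ω) = g m)
    (ρ : Γ) (hρ : ∀ m : M₀, ρ • (m : Ω) = m) : π ρ (π σ z) = π σ z := by
  have hfix : ∀ m : M₀, (σ⁻¹ * ρ * σ) • (m : Ω) = m := by
    intro m
    rw [mul_smul, mul_smul, hσ, hρ (g m), ← hσ, inv_smul_smul]
  calc π ρ (π σ z) = π (σ * (σ⁻¹ * ρ * σ)) z := by
        rw [← Module.End.mul_apply, ← map_mul, ← mul_assoc, ← mul_assoc, mul_inv_cancel, one_mul]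
    _ = π σ z := by rw [map_mul, Module.End.mul_apply, hzN _ hfix]

omit [FiniteDimensional k M₀] [IsGalois k M₀] in
/-- Every `σ ∈ Γ` induces an element of `Gal(M₀/k)` (as `Γ` fixes `k` and `M₀/k` is normal).
[folklore] -/
theorem exists_algEquiv_forall_smul_eq [SMulCommClass Γ k Ω] [Normal k M₀] (σ : Γ) :
    ∃ g : M₀ ≃ₐ[k] M₀, ∀ m : M₀, σ • (m : Ω) = g m := by
  refine ⟨(MulSemiringAction.toAlgEquiv k Ω σ).restrictNormal M₀, fun m => ?_⟩
  have h := AlgEquiv.restrictNormal_commutes (MulSemiringAction.toAlgEquiv k Ω σ) M₀ m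
  rw [MulSemiringAction.toAlgEquiv_apply] at h
  exact h.symm

/-- **Galois descent of label components.**  Let `Γ` act on the field `Ω ⊇ k` fixing `k`, let
`M₀/k` be a finite Galois subextension of `Ω` all of whose `k`-automorphisms are induced by
elements of `Γ` (`hlift`), and let `W` be an `E`-vector space with an `E`-linear representation
`π` of `Γ` and a commuting `E`-linear action `act` of `Ω`, semilinear: `π σ (a · x) = σ(a) · π σ x`.
Let `τ : k → E`, `μ : M₀ → E` with `μ|_k = τ`, and let `F ≤ W` be an `E`-subspace stable under
`π(Γ)` and `act(M₀)`.  Then the `τ`-component of the `Γ`-invariants and the `μ`-component of the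
invariants of `Γ_{M₀} = {σ | σ|_{M₀} = id}` have isomorphic intersections with `F`:
`{x ∈ W^Γ | k acts via τ} ∩ F ≃ₗ[E] {x ∈ W^{Γ_{M₀}} | M₀ acts via μ} ∩ F`
(the two subspaces are supplied as `Dk`, `DM` through their membership conditions).
The isomorphism is `x ↦ L₁(act θ) x` (Lagrange projector onto the `μ`-eigencomponent, `θ` a
primitive element) with inverse `y ↦ ∑_{g ∈ Gal(M₀/k)} π(σ_g) y` (`σ_g` a lift of `g`).
[cite: BrinonConrad2009, Prop. 6.3.8] [cite: Patrikis2019, §2.3.1] -/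
theorem nonempty_linearEquiv_inf_of_labelComponent [SMulCommClass Γ k Ω]
    (hπ : ∀ (σ : Γ) (a : Ω) (x : W), π σ (act a x) = act (σ • a) (π σ x))
    (hlift : ∀ g : M₀ ≃ₐ[k] M₀, ∃ σ : Γ, ∀ m : M₀, σ • (m : Ω) = g m)
    (hμ : ∀ c : k, μ (algebraMap k M₀ c) = τ c)
    (F : Submodule E W) (hFπ : ∀ σ : Γ, ∀ x ∈ F, π σ x ∈ F)
    (hFa : ∀ m : M₀, ∀ x ∈ F, act (m : Ω) x ∈ F)
    (Dk DM : Submodule E W)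
    (hDk : ∀ x, x ∈ Dk ↔ (∀ σ : Γ, π σ x = x) ∧ ∀ c : k, act (algebraMap k Ω c) x = τ c • x)
    (hDM : ∀ x, x ∈ DM ↔
      (∀ σ : Γ, (∀ m : M₀, σ • (m : Ω) = m) → π σ x = x) ∧ ∀ m : M₀, act (m : Ω) x = μ m • x) :
    Nonempty (↥(Dk ⊓ F) ≃ₗ[E] ↥(DM ⊓ F)) := by
  classical
  -- primitive element `θ`, the operator `T = act θ`, the nodes `v g = μ (g⁻¹ θ)`, lifts `σg g`
  let pb : PowerBasis k M₀ := Field.powerBasisOfFiniteOfSeparable k M₀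
  let θ : Ω := ((pb.gen : M₀) : Ω)
  let T : Module.End E W := act θ
  let v : (M₀ ≃ₐ[k] M₀) → E := fun g => μ (g.symm pb.gen)
  have hv : Function.Injective v := injective_label_nodes M₀ pb μ
  choose σg hσg using hlift
  -- the Lagrange projectors `P g = L_g(T)`
  let P : (M₀ ≃ₐ[k] M₀) → Module.End E W := fun g => aeval T (Lagrange.basis Finset.univ v g)
  have hP : ∀ g, P g = aeval T (Lagrange.basis Finset.univ v g) := fun g => rfl
  -- the label characters `μ_g = μ ∘ g⁻¹`
  let μg : (M₀ ≃ₐ[k] M₀) → M₀ →+* E := fun g => μ.comp (g.symm : M₀ →+* M₀)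
  have hμg : ∀ g m, μg g m = μ (g.symm m) := fun g m => rfl
  have hμgk : ∀ (g : M₀ ≃ₐ[k] M₀) (c : k), μg g (algebraMap k M₀ c) = τ c := by
    intro g c; rw [hμg, AlgEquiv.commutes, hμ]
  have hμg_gen : ∀ g, μg g pb.gen = v g := fun g => rfl
  -- basic invariances of the condition "`k` acts through `τ`"
  have hτT : ∀ x : W, (∀ c : k, act (algebraMap k Ω c) x = τ c • x) →
      ∀ c : k, act (algebraMap k Ω c) (T x) = τ c • T x :=
    fun x hx c => act_algebraMap_act_eq_smul act τ hx θ c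
  have hτP : ∀ (g) (x : W), (∀ c : k, act (algebraMap k Ω c) x = τ c • x) →
      ∀ c : k, act (algebraMap k Ω c) (P g x) = τ c • P g x := by
    intro g x hx c
    rw [hP, apply_aeval_of_forall_apply_eq (act (algebraMap k Ω c)) T
      (fun y => act_comm act _ _ y) _ x, hx, map_smul]
  -- `σ` fixing `M₀` commutes with `T`, hence with each `P g`
  have hNT : ∀ σ : Γ, (∀ m : M₀, σ • (m : Ω) = m) → ∀ x, π σ (T x) = T (π σ x) := by
    intro σ hσ x
    show π σ (act θ x) = act θ (π σ x)
    rw [hπ, hσ]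
  have hNP : ∀ σ : Γ, (∀ m : M₀, σ • (m : Ω) = m) → ∀ g x, π σ (P g x) = P g (π σ x) :=
    fun σ hσ g x => apply_aeval_of_forall_apply_eq (π σ) T (hNT σ hσ) _ x
  -- eigen-property of the components of a vector on which `k` acts through `τ`
  have heig : ∀ x : W, (∀ c : k, act (algebraMap k Ω c) x = τ c • x) →
      ∀ g, T (P g x) = v g • P g x := fun x hx g =>
    apply_aeval_basis_eq_smul_of_aeval_nodal_eq_zero T
      (aeval_nodal_labels_apply_eq_zero act M₀ pb τ μ hμ hx) g
  -- the components of `x ∈ D_k` lie in the `μ_g`-label components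
  have hcompN : ∀ x ∈ Dk, ∀ g (σ : Γ), (∀ m : M₀, σ • (m : Ω) = m) → π σ (P g x) = P g x := by
    intro x hx g σ hσ
    rw [hNP σ hσ, ((hDk x).1 hx).1 σ]
  have hcompA : ∀ x ∈ Dk, ∀ g (m : M₀), act (m : Ω) (P g x) = μg g m • P g x := by
    intro x hx g m
    exact act_eq_smul_of_act_gen act M₀ pb τ (hμgk g) (hτP g x ((hDk x).1 hx).2)
      (by rw [hμg_gen]; exact heig x ((hDk x).1 hx).2 g) m
  -- KEY: `π (σg g) (P 1 x) = P g x` for `x ∈ D_k`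
  have hkey : ∀ x ∈ Dk, ∀ g, π (σg g) (P 1 x) = P g x := by
    intro x hx g
    -- decomposition of `x = π (σg g) x` along `h ↦ π (σg g) (P (g⁻¹ * h) x)`
    let y : (M₀ ≃ₐ[k] M₀) → W := fun h => π (σg g) (P (g⁻¹ * h) x)
    have hy : ∀ h, T (y h) = v h • y h := by
      intro h
      have e := act_apply_eq_smul_of_lift π act M₀ hπ (hcompA x hx (g⁻¹ * h)) (hσg g) pb.gen
      -- `μ_{g⁻¹ h} (g⁻¹ θ) = μ (h⁻¹ θ) = v h`
      have hval : μg (g⁻¹ * h) (g.symm pb.gen) = v h := by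
        rw [hμg]
        show μ ((g⁻¹ * h).symm (g.symm pb.gen)) = μ (h.symm pb.gen)
        congr 1
        rw [show (g⁻¹ * h).symm = (g⁻¹ * h)⁻¹ from rfl, mul_inv_rev, inv_inv, AlgEquiv.mul_apply,
          show g.symm = g⁻¹ from rfl, ← AlgEquiv.mul_apply g g⁻¹, mul_inv_cancel, AlgEquiv.one_apply]
        rfl
      rw [hval] at e
      exact e
    have hsum : x = ∑ h, y h := by
      calc x = π (σg g) x := (((hDk x).1 hx).1 _).symm
        _ = π (σg g) (∑ h, P h x) := by rw [sum_aeval_basis_apply T hv x]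
        _ = ∑ h, π (σg g) (P h x) := map_sum _ _ _
        _ = ∑ h, y h := (Equiv.sum_comp (Equiv.mulLeft g⁻¹) (fun h => π (σg g) (P h x))).symm
    have h2 := aeval_basis_sum_eq T hv hy g
    rw [← hsum] at h2
    -- `h2 : P g x = y g = π (σg g) (P (g⁻¹ * g) x)`
    rw [h2]
    show π (σg g) (P 1 x) = π (σg g) (P (g⁻¹ * g) x)
    rw [inv_mul_cancel]
  -- the two maps
  let f : W →ₗ[E] W := P 1
  let gs : W →ₗ[E] W := ∑ g, π (σg g)
  have hgs : ∀ y, gs y = ∑ g, π (σg g) y := fun y => LinearMap.sum_apply _ _ y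
  -- `f` maps `D_k ∩ F` into `D_M ∩ F`
  have hf_mem : ∀ x ∈ Dk ⊓ F, f x ∈ DM ⊓ F := by
    intro x hx
    obtain ⟨hxD, hxF⟩ := Submodule.mem_inf.1 hx
    refine Submodule.mem_inf.2 ⟨(hDM _).2 ⟨hcompN x hxD 1, fun m => ?_⟩,
      aeval_apply_mem_of_forall_mem T (hFa pb.gen) _ hxF⟩
    rw [hcompA x hxD 1 m, hμg]
    rfl
  -- `gs` maps `D_M ∩ F` into `D_k ∩ F`
  have hgs_mem : ∀ y ∈ DM ⊓ F, gs y ∈ Dk ⊓ F := by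
    intro y hy
    obtain ⟨hyD, hyF⟩ := Submodule.mem_inf.1 hy
    obtain ⟨hyN, hyA⟩ := (hDM y).1 hyD
    rw [hgs]
    refine Submodule.mem_inf.2 ⟨(hDk _).2 ⟨fun σ => ?_, fun c => ?_⟩,
      Submodule.sum_mem _ fun g _ => hFπ _ _ hyF⟩
    · -- `Γ`-invariance: `σ σ_g ≡ σ_{ḡ g}` modulo elements fixing `M₀`
      obtain ⟨gbar, hgbar⟩ := exists_algEquiv_forall_smul_eq M₀ σ
      rw [map_sum]
      have hterm : ∀ g, π σ (π (σg g) y) = π (σg (gbar * g)) y := by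
        intro g
        have hfix : ∀ m : M₀, ((σg (gbar * g))⁻¹ * σ * σg g) • (m : Ω) = m := by
          intro m
          rw [mul_smul, mul_smul, hσg g, hgbar (g m), inv_smul_eq_iff, hσg (gbar * g),
            AlgEquiv.mul_apply]
        calc π σ (π (σg g) y) = π (σg (gbar * g) * ((σg (gbar * g))⁻¹ * σ * σg g)) y := by
              rw [← Module.End.mul_apply, ← map_mul, ← mul_assoc, ← mul_assoc, mul_inv_cancel,
                one_mul]
          _ = π (σg (gbar * g)) y := by rw [map_mul, Module.End.mul_apply, hyN _ hfix]
      simp_rw [hterm]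
      exact Equiv.sum_comp (Equiv.mulLeft gbar) (fun g => π (σg g) y)
    · -- `k` acts through `τ`
      rw [map_sum, Finset.smul_sum]
      refine Finset.sum_congr rfl fun g _ => ?_
      have e := act_apply_eq_smul_of_lift π act M₀ hπ hyA (hσg g) (algebraMap k M₀ c)
      rw [AlgEquiv.commutes, hμ] at e
      exact e
  refine ⟨LinearEquiv.ofLinear ((f.domRestrict (Dk ⊓ F)).codRestrict (DM ⊓ F) fun x => hf_mem x x.2)
    ((gs.domRestrict (DM ⊓ F)).codRestrict (Dk ⊓ F) fun y => hgs_mem y y.2) ?_ ?_⟩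
  · -- `f ∘ gs = id` on `D_M ∩ F`
    refine LinearMap.ext fun y => Subtype.ext ?_
    obtain ⟨hyD, -⟩ := Submodule.mem_inf.1 y.2
    obtain ⟨hyN, hyA⟩ := (hDM y).1 hyD
    show f (gs y) = y
    have hy' : ∀ g, T (π (σg g) y) = v g • π (σg g) y := fun g =>
      act_apply_eq_smul_of_lift π act M₀ hπ hyA (hσg g) pb.gen
    rw [hgs, show f = P 1 from rfl, aeval_basis_sum_eq T hv hy' 1]
    exact hyN _ fun m => by rw [hσg 1, AlgEquiv.one_apply]
  · -- `gs ∘ f = id` on `D_k ∩ F`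
    refine LinearMap.ext fun x => Subtype.ext ?_
    obtain ⟨hxD, -⟩ := Submodule.mem_inf.1 x.2
    show gs (f x) = x
    rw [hgs]
    simp_rw [show f = P 1 from rfl, hkey x hxD]
    exact sum_aeval_basis_apply T hv x

/-- **Equality of dimensions of label components under Galois descent** (corollary of
`nonempty_linearEquiv_inf_of_labelComponent`): `dim_E (D_k(τ) ∩ F) = dim_E (D_{M₀}(μ) ∩ F)`.
[cite: BrinonConrad2009, Prop. 6.3.8] [cite: Patrikis2019, §2.3.1] -/
theorem finrank_inf_eq_of_labelComponent [SMulCommClass Γ k Ω]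
    (hπ : ∀ (σ : Γ) (a : Ω) (x : W), π σ (act a x) = act (σ • a) (π σ x))
    (hlift : ∀ g : M₀ ≃ₐ[k] M₀, ∃ σ : Γ, ∀ m : M₀, σ • (m : Ω) = g m)
    (hμ : ∀ c : k, μ (algebraMap k M₀ c) = τ c)
    (F : Submodule E W) (hFπ : ∀ σ : Γ, ∀ x ∈ F, π σ x ∈ F)
    (hFa : ∀ m : M₀, ∀ x ∈ F, act (m : Ω) x ∈ F)
    (Dk DM : Submodule E W)
    (hDk : ∀ x, x ∈ Dk ↔ (∀ σ : Γ, π σ x = x) ∧ ∀ c : k, act (algebraMap k Ω c) x = τ c • x)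
    (hDM : ∀ x, x ∈ DM ↔
      (∀ σ : Γ, (∀ m : M₀, σ • (m : Ω) = m) → π σ x = x) ∧ ∀ m : M₀, act (m : Ω) x = μ m • x) :
    Module.finrank E ↥(Dk ⊓ F) = Module.finrank E ↥(DM ⊓ F) := by
  obtain ⟨e⟩ := nonempty_linearEquiv_inf_of_labelComponent π act M₀ τ μ hπ hlift hμ F hFπ hFa
    Dk DM hDk hDM
  exact e.finrank_eq

end Main

end Literature.FieldTheory.Galois

end
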